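import Summits.CriticalPhenomena.PercolationContinuityZ3.Theorems.Transplant.SkelNegBParamsFaceFloorsPiXA
import HarnessLib

/-!
# N1 params, M3 groups G-Z and G-π (y′-face), generic in the y′-face skeleton-to-be's choice functions — the fields `hfR`, `hZfar` (habitat versus the
# Λ-ceilings `kA 0 := kF₀A`, `kA 1 := kF₁A`, now along axis `1`) and `hπ2Y`, `hπ3Y` (the along y′-run's drift and the tangential x-run's origin within the
# window radius `r`) of `Skelφ.FloorsY2` (SkelPhiFaceNumsYP2 :43–:45, :102–:105) at M3-FLOORS-SIGNATURE §1 / hp-8 g36's F-GLUE-CONSUMER-SHAPE.md §2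
# (`pr := prFA` — here with `h_L`, `v_L` literal —, `ℓ' := ℓ_L`, `P := fcellsA`, `b₀ := b0TA`, `k₀ := 3`, `Mz := M_u`, `kA` the literal lambda, `R's = R'₃ := RA′ mk`;
# the landing origin `yL`, the counts `Nr`, `N₃` and the start half-width `qB` free) (p1-g14, 2026-08-22; the p1 lineage's M3 share = G-clr/G-Z/G-π, both faces).
Served hypotheses, as for the x-face twins (FloorsZXA p323166 / FloorsPiXA): `hkF0/hkF1` (= `KS.kFA_le`), `hs1 : 6·RA′ + 11 ≤ u₁A` (= `uA_oth_facts … 0`),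
`hkE8 : kE + 8·u₀A + 8 ≤ 5·r₀` (= `(NegB.hkE_apron_RA … 1).1`), `hyl : |yL|₁ ≤ YbF` (origin inside core 1 of `B_F`), the count ranges `Nr + 1 ≤ 1000·Kq`,
`N₃ + 1 ≤ 1000·Kq` (= `counts_budget`-type facts), `hSF : 16·S_F ≤ M_L`, and THE ONE r-FLOOR `hr : ∀ X, X + 1 ≤ exA → X ≤ r`.
* **`hfR_YA_gen`**, **`hZfar_YA_gen`** (`du.1 = 1`); `clr_crossOffY_l1` (`|yT|₁ ≤ |yL|₁ + (Nr+1)·(11·n_L + ℓ_L) + 1`), `clr_floorπY_exA` (the y-budget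
  `YbF + 1000·Kq·U + 11000·Kq·n_L + 1000·Kq·ℓ_L + 13 + 1 ≤ exA`), **`hπ2Y_YA_gen`**, **`hπ3Y_YA_gen`**.
builds on p205010 (kernel theorem, internal audit signed; external expert review pending) — nothing in this file uses p205010; NOTHING is claimed about the node
`SamePDropOfSkeletonNeg₁` (OPEN); integer arithmetic only.
Lane `prim-bschramm-*`, seat `prim-bschramm-p1` (gen 14); helper file (`--supports stmt-CriticalPhenomena-4575 --as helper`); slot-ledger ζ′ v1/v2 (ex-monotone).
[cite: KozmaNitzan2024, §4 Lemma 12 (pp. 23–25)] [cite: MartineauTassion2017, §4.1, §4.3 Lemma 4.2]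
-/

noncomputable section

open scoped Classical

namespace Summit.CriticalPhenomena.PercolationContinuityZ3.Theorems.Transplant

namespace PlanarSkeletonNeg

namespace NegB

open Literature.Probability.Percolation Literature.Probability.LatticeModels SimpleGraph
open Literature.Probability.Percolation.KozmaNitzan.Cells (oth sgOf sgOf_sign)
open SkelConc (Consts)
open Skelφ (shearUnit shearUnit_pos crossOffY yPrmW)
open Skelφ.StepI (DataN)
open TwoAxis.Para (modulus)
open Neg

namespace KS

section FloorsZY

variable (κ : Consts) {V : Type} [DecidableEq V] [Countable V] {G : SimpleGraph V} [G.LocallyFinite] (Φ : PlanarSkeletonNeg G) (t : V)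
  (p : unitInterval) (D : DataN V) (c mk g f : ℕ)

/-- **M3 y′-face field `hfR`, generic** (`du.1 = 1`): `flo = 5r₁ + 10u₁j + 3 − lev ≤ −kF₁A`, `kF₁A ≤ fhi = 25r₁ − 2 − lev`, transversally
`kF₀A ≤ 5r₀ − 7 − |z 0 − cen x 0|`. [cite: KozmaNitzan2024, §4 Lemma 12 (pp. 23–25)] -/
theorem hfR_YA_gen (x : Site 2) (du : MDir) (hd : du.1 = 1) (j : ℕ) (hj : j < (fcellsA κ Φ t p D g f).K) (z : Site 2) {E : ℕ} {kE : ℤ}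
    (hlev1 : (fcellsA κ Φ t p D g f).faceL 1 j - E ≤ (fcellsA κ Φ t p D g f).lev du x z) (hlev2 : (fcellsA κ Φ t p D g f).lev du x z ≤ (fcellsA κ Φ t p D g f).faceL 1 j + E)
    (hz : |z 0 - (fcellsA κ Φ t p D g f).cen x 0| ≤ kE) (hEu : (E : ℤ) ≤ u₁A κ Φ t p D g f)
    (hkF0 : kF₀A κ Φ t p D c mk g f ≤ 8 * u₀A κ Φ t p D g f + 1) (hkF1 : kF₁A κ Φ t p D c mk g f ≤ 8 * u₁A κ Φ t p D g f + 1)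
    (hs1 : 6 * (RA' κ Φ t p D mk : ℤ) + 11 ≤ u₁A κ Φ t p D g f) (hkE8 : kE + 8 * u₀A κ Φ t p D g f + 8 ≤ 5 * ((fcellsA κ Φ t p D g f).r 0 : ℤ)) :
    (5 * ((fcellsA κ Φ t p D g f).r du.1 : ℤ) + 10 * (fcellsA κ Φ t p D g f).s du.1 * j + 3 - (fcellsA κ Φ t p D g f).lev du x z) ≤ -((fun i : Fin 2 => if i = 0 then kF₀A κ Φ t p D c mk g f else kF₁A κ Φ t p D c mk g f) du.1) ∧ ((fun i : Fin 2 => if i = 0 then kF₀A κ Φ t p D c mk g f else kF₁A κ Φ t p D c mk g f) du.1) ≤ (25 * ((fcellsA κ Φ t p D g f).r du.1 : ℤ) - 2 - (fcellsA κ Φ t p D g f).lev du x z) ∧ ((fun i : Fin 2 => if i = 0 then kF₀A κ Φ t p D c mk g f else kF₁A κ Φ t p D c mk g f) (oth du.1)) ≤ (5 * ((fcellsA κ Φ t p D g f).r (oth du.1) : ℤ) - 4 - (3 : ℤ) - |z (oth du.1) - (fcellsA κ Φ t p D g f).cen x (oth du.1)|) := by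
  rw [hd, show oth (1 : Fin 2) = 0 from rfl]
  simp only [if_true, show ((1 : Fin 2) = 0) = False from propext ⟨fun h => absurd h (by decide), False.elim⟩, if_false]
  have hR0 : (0 : ℤ) ≤ (RA' κ Φ t p D mk : ℤ) := Nat.cast_nonneg _
  have hr : ((fcellsA κ Φ t p D g f).r 1 : ℤ) = 40 * (Neg.Kq κ : ℤ) * u₁A κ Φ t p D g f := (units_eqA κ Φ t p D g f).2.2.2.1
  have hq : (1 : ℤ) ≤ Neg.Kq κ := by exact_mod_cast Neg.one_le_Kq κ
  have es : (((fcellsA κ Φ t p D g f).s 1 : ℕ) : ℤ) = u₁A κ Φ t p D g f := rfl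
  have hjK : ((j + 1 : ℕ) : ℤ) ≤ ((fcellsA κ Φ t p D g f).K : ℤ) := by exact_mod_cast hj
  have hfl : (fcellsA κ Φ t p D g f).faceL 1 j = 5 * ((fcellsA κ Φ t p D g f).r 1 : ℤ) + 10 * u₁A κ Φ t p D g f * ((j : ℤ) + 1) - 1 := by
    unfold PCells2.faceL; rw [es]; push_cast; ring
  have hrK : ((fcellsA κ Φ t p D g f).r 1 : ℤ) = ((fcellsA κ Φ t p D g f).K : ℤ) * u₁A κ Φ t p D g f := by unfold u₁A; rw [PCells2.r_eq]
  rw [es]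
  rw [hfl] at hlev1 hlev2
  have hu : 1 ≤ u₁A κ Φ t p D g f := (units_eqA κ Φ t p D g f).2.2.2.2.2.2.2
  have hQu : u₁A κ Φ t p D g f ≤ (Neg.Kq κ : ℤ) * u₁A κ Φ t p D g f := le_mul_of_one_le_left (by linarith) hq
  have hz' := (abs_nonneg _).trans hz
  have hjr : 10 * u₁A κ Φ t p D g f * ((j : ℤ) + 1) ≤ 10 * ((fcellsA κ Φ t p D g f).r 1 : ℤ) := by
    rw [hrK]; have : ((j : ℤ) + 1) = ((j + 1 : ℕ) : ℤ) := by push_cast; ring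
    rw [this]; nlinarith
  refine ⟨by linarith, by linarith, by linarith⟩

/-- **M3 y′-face field `hZfar`, generic** (`du.1 = 1`): `lev + kF₁A + 1 < 20r₁ − b0TA 1`. [cite: KozmaNitzan2024, §4 Lemma 12 (pp. 23–25)] -/
theorem hZfar_YA_gen (x : Site 2) (du : MDir) (hd : du.1 = 1) (j : ℕ) (hj : j < (fcellsA κ Φ t p D g f).K) (z : Site 2) {E : ℕ}
    (hlev2 : (fcellsA κ Φ t p D g f).lev du x z ≤ (fcellsA κ Φ t p D g f).faceL 1 j + E) (hEu : (E : ℤ) ≤ u₁A κ Φ t p D g f)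
    (hkF1 : kF₁A κ Φ t p D c mk g f ≤ 8 * u₁A κ Φ t p D g f + 1) :
    (fcellsA κ Φ t p D g f).lev du x z + ((fun i : Fin 2 => if i = 0 then kF₀A κ Φ t p D c mk g f else kF₁A κ Φ t p D c mk g f) du.1) + 1 < 20 * ((fcellsA κ Φ t p D g f).r du.1 : ℤ) - (b0TA κ Φ t p D g f) du.1 := by
  rw [hd]
  simp only [show ((1 : Fin 2) = 0) = False from propext ⟨fun h => absurd h (by decide), False.elim⟩, if_false]
  have hr : ((fcellsA κ Φ t p D g f).r 1 : ℤ) = 40 * (Neg.Kq κ : ℤ) * u₁A κ Φ t p D g f := (units_eqA κ Φ t p D g f).2.2.2.1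
  have hb : (b0TA κ Φ t p D g f 1 : ℤ) = 10 * (Neg.Kq κ : ℤ) * u₁A κ Φ t p D g f := (units_eqA κ Φ t p D g f).2.2.2.2.2.1
  have hq : (1 : ℤ) ≤ Neg.Kq κ := by exact_mod_cast Neg.one_le_Kq κ
  have hu : 1 ≤ u₁A κ Φ t p D g f := (units_eqA κ Φ t p D g f).2.2.2.2.2.2.2
  have es : (((fcellsA κ Φ t p D g f).s 1 : ℕ) : ℤ) = u₁A κ Φ t p D g f := rfl
  have hjK : ((j + 1 : ℕ) : ℤ) ≤ ((fcellsA κ Φ t p D g f).K : ℤ) := by exact_mod_cast hj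
  have hfl : (fcellsA κ Φ t p D g f).faceL 1 j = 5 * ((fcellsA κ Φ t p D g f).r 1 : ℤ) + 10 * u₁A κ Φ t p D g f * ((j + 1 : ℕ) : ℤ) - 1 := by
    unfold PCells2.faceL; rw [es]
  have hrK : ((fcellsA κ Φ t p D g f).r 1 : ℤ) = ((fcellsA κ Φ t p D g f).K : ℤ) * u₁A κ Φ t p D g f := by unfold u₁A; rw [PCells2.r_eq]
  have hjr : 10 * u₁A κ Φ t p D g f * ((j + 1 : ℕ) : ℤ) ≤ 10 * ((fcellsA κ Φ t p D g f).r 1 : ℤ) := by rw [hrK]; nlinarith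
  have hQu : u₁A κ Φ t p D g f ≤ (Neg.Kq κ : ℤ) * u₁A κ Φ t p D g f := le_mul_of_one_le_left (by linarith) hq
  rw [hfl] at hlev2
  rw [hb]
  linarith

end FloorsZY

/-! ## The y′-face reaches -/

section FloorsPiY

variable (κ : Consts) {V : Type} [DecidableEq V] [Countable V] {G : SimpleGraph V} [G.LocallyFinite] (Φ : PlanarSkeletonNeg G) (t : V)
  (p : unitInterval) (D : DataN V) (c mk g f : ℕ)

/-- **The tangential x-run's origin of a y′-face is within reach**: `|yT 0| + |yT 1| ≤ |yL 0| + |yL 1| + (Nr+1)·(11·n_L + ℓ_L) + 1` for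
`yT = yL + crossOffY n_L ℓ_L h_L v_L σ Nr` (`σ = ±1`, `|v_L| ≤ n_L`, `|h_L| ≤ 10·n_L`, `ℓ_L ≥ 11`). [folklore] -/
theorem clr_crossOffY_l1 (hN : EqNumL κ Φ t p D g f) (hκ : (hL κ Φ t p D g f).natAbs ≤ 10 * nL κ Φ t p D g f)
    (hℓA : 22000 * Neg.Kq κ * (RA' κ Φ t p D mk + 2) ≤ ℓL κ Φ t p D g f) (yL : Site 2) {σ : ℤ} (hσ : σ = 1 ∨ σ = -1) (Nr : ℕ) :
    ((yL + crossOffY (nL κ Φ t p D g f) (ℓL κ Φ t p D g f) (hL κ Φ t p D g f) (vL κ Φ t p D g f) σ Nr) 0).natAbs +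
        ((yL + crossOffY (nL κ Φ t p D g f) (ℓL κ Φ t p D g f) (hL κ Φ t p D g f) (vL κ Φ t p D g f) σ Nr) 1).natAbs ≤
      (yL 0).natAbs + (yL 1).natAbs + (Nr + 1) * (11 * nL κ Φ t p D g f + ℓL κ Φ t p D g f) + 1 := by
  obtain ⟨hn1, -⟩ := one_le_of_eqNumL κ Φ t p D g f hN
  have hn0 : (0 : ℤ) < (nL κ Φ t p D g f : ℤ) := by exact_mod_cast hn1
  have hv := hN.v_le
  have hκ' : |hL κ Φ t p D g f| ≤ 10 * (nL κ Φ t p D g f : ℤ) := by rw [← Int.natCast_natAbs]; exact_mod_cast hκ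
  have hU := shearUnit_pos hn1 (hL κ Φ t p D g f)
  obtain ⟨-, hU2⟩ := clr_shearUnit_bounds κ Φ t p D g f hκ
  have hσabs : |σ| = 1 := by rcases hσ with h | h <;> simp [h]
  have hq1 : 1 ≤ Neg.Kq κ := Neg.one_le_Kq κ
  have hℓ11 : (11 : ℤ) ≤ (ℓL κ Φ t p D g f : ℤ) := by
    have h2 : 1 * (0 + 2) ≤ Neg.Kq κ * (RA' κ Φ t p D mk + 2) := Nat.mul_le_mul hq1 (by omega)
    have : 11 ≤ ℓL κ Φ t p D g f := by nlinarith only [hℓA, h2]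
    exact_mod_cast this
  have hnℓ : (nL κ Φ t p D g f : ℤ) * 11 ≤ (nL κ Φ t p D g f : ℤ) * ℓL κ Φ t p D g f := mul_le_mul_of_nonneg_left hℓ11 hn0.le
  -- the along stride and its size
  set sLo : ℤ := ((nL κ Φ t p D g f : ℤ) * ℓL κ Φ t p D g f - (shearUnit (nL κ Φ t p D g f) (hL κ Φ t p D g f) : ℕ) + 1) /
    (shearUnit (nL κ Φ t p D g f) (hL κ Φ t p D g f) : ℕ) with hsLo
  have sL' : (shearUnit (nL κ Φ t p D g f) (hL κ Φ t p D g f) : ℤ) * sLo ≤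
      (nL κ Φ t p D g f : ℤ) * ℓL κ Φ t p D g f - (shearUnit (nL κ Φ t p D g f) (hL κ Φ t p D g f) : ℤ) + 1 := by rw [hsLo]; exact Int.mul_ediv_self_le hU.ne'
  have hs0 : 0 ≤ sLo := by rw [hsLo]; exact Int.ediv_nonneg (by linarith only [hU2, hnℓ]) hU.le
  have hk0 : (0 : ℤ) ≤ (Nr : ℤ) + 1 := by positivity
  -- coordinates of the offset
  have e0 : (yL + crossOffY (nL κ Φ t p D g f) (ℓL κ Φ t p D g f) (hL κ Φ t p D g f) (vL κ Φ t p D g f) σ Nr) 0 =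
      yL 0 + σ * (((Nr : ℤ) + 1) * vL κ Φ t p D g f) := by
    simp only [Pi.add_apply, Skelφ.crossOffY, Skelφ.pt_zero]
  set X : ℤ := σ * (((Nr : ℤ) + 1) * sLo) * (shearUnit (nL κ Φ t p D g f) (hL κ Φ t p D g f) : ℤ) + hL κ Φ t p D g f * (σ * (((Nr : ℤ) + 1) * vL κ Φ t p D g f)) with hX
  have e1 : (yL + crossOffY (nL κ Φ t p D g f) (ℓL κ Φ t p D g f) (hL κ Φ t p D g f) (vL κ Φ t p D g f) σ Nr) 1 = yL 1 + X / (nL κ Φ t p D g f : ℤ) := by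
    simp only [Pi.add_apply, Skelφ.crossOffY, Skelφ.pt_one, hX, hsLo]
  -- `|X| ≤ (Nr+1)·(nℓ + 10 n²)`, so `|X / n| ≤ (Nr+1)(ℓ + 10n) + 1`
  have hUs : (shearUnit (nL κ Φ t p D g f) (hL κ Φ t p D g f) : ℤ) * sLo ≤ (nL κ Φ t p D g f : ℤ) * ℓL κ Φ t p D g f := by linarith only [sL', hU]
  have a1 : |σ * (((Nr : ℤ) + 1) * sLo) * (shearUnit (nL κ Φ t p D g f) (hL κ Φ t p D g f) : ℤ)| ≤ ((Nr : ℤ) + 1) * ((nL κ Φ t p D g f : ℤ) * ℓL κ Φ t p D g f) := by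
    have e : σ * (((Nr : ℤ) + 1) * sLo) * (shearUnit (nL κ Φ t p D g f) (hL κ Φ t p D g f) : ℤ) = σ * (((Nr : ℤ) + 1) * ((shearUnit (nL κ Φ t p D g f) (hL κ Φ t p D g f) : ℤ) * sLo)) := by ring
    rw [e, abs_mul, hσabs, one_mul, abs_of_nonneg (mul_nonneg hk0 (mul_nonneg hU.le hs0))]
    exact mul_le_mul_of_nonneg_left hUs hk0
  have a2 : |hL κ Φ t p D g f * (σ * (((Nr : ℤ) + 1) * vL κ Φ t p D g f))| ≤ 10 * (nL κ Φ t p D g f : ℤ) * (((Nr : ℤ) + 1) * (nL κ Φ t p D g f : ℤ)) := by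
    rw [abs_mul, abs_mul, hσabs, one_mul, abs_mul, abs_of_nonneg hk0]
    exact mul_le_mul hκ' (mul_le_mul_of_nonneg_left hv hk0) (by positivity) (by positivity)
  have hXabs : |X| ≤ (nL κ Φ t p D g f : ℤ) * (((Nr : ℤ) + 1) * ((ℓL κ Φ t p D g f : ℤ) + 10 * (nL κ Φ t p D g f : ℤ))) := by
    rw [hX]
    calc |σ * (((Nr : ℤ) + 1) * sLo) * (shearUnit (nL κ Φ t p D g f) (hL κ Φ t p D g f) : ℤ) + hL κ Φ t p D g f * (σ * (((Nr : ℤ) + 1) * vL κ Φ t p D g f))|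
        ≤ |σ * (((Nr : ℤ) + 1) * sLo) * (shearUnit (nL κ Φ t p D g f) (hL κ Φ t p D g f) : ℤ)| + |hL κ Φ t p D g f * (σ * (((Nr : ℤ) + 1) * vL κ Φ t p D g f))| :=
          abs_add_le _ _
      _ ≤ ((Nr : ℤ) + 1) * ((nL κ Φ t p D g f : ℤ) * ℓL κ Φ t p D g f) + 10 * (nL κ Φ t p D g f : ℤ) * (((Nr : ℤ) + 1) * (nL κ Φ t p D g f : ℤ)) := add_le_add a1 a2
      _ = (nL κ Φ t p D g f : ℤ) * (((Nr : ℤ) + 1) * ((ℓL κ Φ t p D g f : ℤ) + 10 * (nL κ Φ t p D g f : ℤ))) := by ring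
  obtain ⟨x1, x2⟩ := abs_le.1 hXabs
  obtain ⟨f1, f2⟩ := RootArith.floor_sandwich (x := X) hn0
  set qq := X / (nL κ Φ t p D g f : ℤ) with hqq
  set M : ℤ := ((Nr : ℤ) + 1) * ((ℓL κ Φ t p D g f : ℤ) + 10 * (nL κ Φ t p D g f : ℤ)) with hM
  have hq1' : qq ≤ M := by
    by_contra hc; push Not at hc
    have : (nL κ Φ t p D g f : ℤ) * (M + 1) ≤ (nL κ Φ t p D g f : ℤ) * qq := mul_le_mul_of_nonneg_left (by linarith) hn0.le
    nlinarith
  have hq2' : -(M + 1) ≤ qq := by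
    by_contra hc; push Not at hc
    have : (nL κ Φ t p D g f : ℤ) * qq ≤ (nL κ Φ t p D g f : ℤ) * (-(M + 1) - 1) := mul_le_mul_of_nonneg_left (by linarith) hn0.le
    nlinarith
  have hqabs : |qq| ≤ M + 1 := abs_le.2 ⟨by linarith, by linarith⟩
  have b0 : |σ * (((Nr : ℤ) + 1) * vL κ Φ t p D g f)| ≤ ((Nr : ℤ) + 1) * (nL κ Φ t p D g f : ℤ) := by
    rw [abs_mul, hσabs, one_mul, abs_mul, abs_of_nonneg hk0]; exact mul_le_mul_of_nonneg_left hv hk0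
  have key : (((yL + crossOffY (nL κ Φ t p D g f) (ℓL κ Φ t p D g f) (hL κ Φ t p D g f) (vL κ Φ t p D g f) σ Nr) 0).natAbs : ℤ) +
      (((yL + crossOffY (nL κ Φ t p D g f) (ℓL κ Φ t p D g f) (hL κ Φ t p D g f) (vL κ Φ t p D g f) σ Nr) 1).natAbs : ℤ) ≤
      ((yL 0).natAbs : ℤ) + ((yL 1).natAbs : ℤ) + ((Nr : ℤ) + 1) * (11 * (nL κ Φ t p D g f : ℤ) + ℓL κ Φ t p D g f) + 1 := by
    simp only [Int.natCast_natAbs]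
    rw [e0, e1]
    have t0 := abs_add_le (yL 0) (σ * (((Nr : ℤ) + 1) * vL κ Φ t p D g f))
    have t1 := abs_add_le (yL 1) qq
    have eM : M + ((Nr : ℤ) + 1) * (nL κ Φ t p D g f : ℤ) = ((Nr : ℤ) + 1) * (11 * (nL κ Φ t p D g f : ℤ) + ℓL κ Φ t p D g f) := by rw [hM]; ring
    linarith
  exact_mod_cast key

/-- **THE y′-FACE G-π BUDGET**: `YbF + 1000·Kq·U + 11000·Kq·n_L + 1000·Kq·ℓ_L + 13 + 1 ≤ exA`. [folklore] -/
theorem clr_floorπY_exA (hκ : (hL κ Φ t p D g f).natAbs ≤ 10 * nL κ Φ t p D g f) (hSF : 16 * SF κ Φ t p D c mk ≤ ML κ Φ t p D g)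
    (hnA : 2000 * Neg.Kq κ * (RA' κ Φ t p D mk + 2) ≤ nL κ Φ t p D g f) :
    YbF κ Φ t p D c mk g f + 1000 * Neg.Kq κ * shearUnit (nL κ Φ t p D g f) (hL κ Φ t p D g f) + 11000 * Neg.Kq κ * nL κ Φ t p D g f +
        1000 * Neg.Kq κ * ℓL κ Φ t p D g f + 13 + 1 ≤ exA κ Φ t p D g f := by
  have hY := clr_YbF_le κ Φ t p D c mk g f hκ hSF hnA
  have hq := Neg.one_le_Kq κ
  have hex := (exR_le_exR2 κ Φ t p D g f).2
  have hn1 : 1 ≤ nL κ Φ t p D g f := by have := (ML_lt_nL κ Φ t p D g f).1; omega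
  have e : exA κ Φ t p D g f = exR2 κ Φ t p D g f +
      Neg.Kq κ * (Yb κ Φ t p D g f + 1000 * shearUnit (nL κ Φ t p D g f) (hL κ Φ t p D g f) + 11055 * nL κ Φ t p D g f + 1000 * ℓL κ Φ t p D g f + 20) +
      exCA κ Φ t p D g f := rfl
  rw [e, Nat.mul_add, Nat.mul_add, Nat.mul_add, Nat.mul_add]
  have e2 : Neg.Kq κ * (1000 * shearUnit (nL κ Φ t p D g f) (hL κ Φ t p D g f)) = 1000 * (Neg.Kq κ * shearUnit (nL κ Φ t p D g f) (hL κ Φ t p D g f)) := by ring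
  have e3 : Neg.Kq κ * (11055 * nL κ Φ t p D g f) = 11055 * (Neg.Kq κ * nL κ Φ t p D g f) := by ring
  have e4 : Neg.Kq κ * (1000 * ℓL κ Φ t p D g f) = 1000 * (Neg.Kq κ * ℓL κ Φ t p D g f) := by ring
  have e5 : 11000 * Neg.Kq κ * nL κ Φ t p D g f = 11000 * (Neg.Kq κ * nL κ Φ t p D g f) := by ring
  have e7 : 1000 * Neg.Kq κ * shearUnit (nL κ Φ t p D g f) (hL κ Φ t p D g f) = 1000 * (Neg.Kq κ * shearUnit (nL κ Φ t p D g f) (hL κ Φ t p D g f)) := by ring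
  have e8 : 1000 * Neg.Kq κ * ℓL κ Φ t p D g f = 1000 * (Neg.Kq κ * ℓL κ Φ t p D g f) := by ring
  have hn : nL κ Φ t p D g f ≤ Neg.Kq κ * nL κ Φ t p D g f := Nat.le_mul_of_pos_left _ hq
  rw [e2, e3, e4, e5, e7, e8]
  omega

/-- **M3 y′-face field `hπ2Y`, generic**: the along y′-run's origin plus every region's drift lies within the window radius `r`, from the ONE
r-floor `hr` (along count `Nr + 1 ≤ 1000·Kq`, origin `|yL|₁ ≤ YbF`). [cite: KozmaNitzan2024, §4 Lemma 12 (pp. 23–25)] -/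
theorem hπ2Y_YA_gen (hN : EqNumL κ Φ t p D g f) (hκ : (hL κ Φ t p D g f).natAbs ≤ 10 * nL κ Φ t p D g f)
    (hnA : 2000 * Neg.Kq κ * (RA' κ Φ t p D mk + 2) ≤ nL κ Φ t p D g f) (hℓA : 22000 * Neg.Kq κ * (RA' κ Φ t p D mk + 2) ≤ ℓL κ Φ t p D g f)
    (hSF : 16 * SF κ Φ t p D c mk ≤ ML κ Φ t p D g) (yL : Site 2) (hyl : (yL 0).natAbs + (yL 1).natAbs ≤ YbF κ Φ t p D c mk g f)
    {Nr : ℕ} (hNr : Nr + 1 ≤ 1000 * Neg.Kq κ) (qB : ℕ) (r : ℕ) (hr : ∀ X : ℕ, X + 1 ≤ exA κ Φ t p D g f → X ≤ r) :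
    ∀ k ≤ Nr, ((yL 0).natAbs + (yL 1).natAbs) + (((((k + 1 : ℕ) : ℤ) * vL κ Φ t p D g f).natAbs +
      (((shearUnit (nL κ Φ t p D g f) (hL κ Φ t p D g f) : ℤ) * |((k + 1 : ℕ) : ℤ) * (yPrmW (nL κ Φ t p D g f) (ℓL κ Φ t p D g f) (hL κ Φ t p D g f) (vL κ Φ t p D g f) (RA' κ Φ t p D mk) qB Nr).sLo| +
        |hL κ Φ t p D g f| * |((k + 1 : ℕ) : ℤ) * vL κ Φ t p D g f| + shearUnit (nL κ Φ t p D g f) (hL κ Φ t p D g f)) / nL κ Φ t p D g f).natAbs + 1)) ≤ r := by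
  intro k hk
  obtain ⟨hn1, -⟩ := one_le_of_eqNumL κ Φ t p D g f hN
  have hn0 : (0 : ℤ) < (nL κ Φ t p D g f : ℤ) := by exact_mod_cast hn1
  have hU := shearUnit_pos hn1 (hL κ Φ t p D g f)
  obtain ⟨-, hU2⟩ := clr_shearUnit_bounds κ Φ t p D g f hκ
  have hκ' : |hL κ Φ t p D g f| ≤ 10 * (nL κ Φ t p D g f : ℤ) := by rw [← Int.natCast_natAbs]; exact_mod_cast hκ
  have hq1 : 1 ≤ Neg.Kq κ := Neg.one_le_Kq κ
  have hℓ11 : (11 : ℤ) ≤ (ℓL κ Φ t p D g f : ℤ) := by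
    have h2 : 1 * (0 + 2) ≤ Neg.Kq κ * (RA' κ Φ t p D mk + 2) := Nat.mul_le_mul hq1 (by omega)
    have : 11 ≤ ℓL κ Φ t p D g f := by nlinarith only [hℓA, h2]
    exact_mod_cast this
  have hnℓ : (nL κ Φ t p D g f : ℤ) * 11 ≤ (nL κ Φ t p D g f : ℤ) * ℓL κ Φ t p D g f := mul_le_mul_of_nonneg_left hℓ11 hn0.le
  have hsLo : (yPrmW (nL κ Φ t p D g f) (ℓL κ Φ t p D g f) (hL κ Φ t p D g f) (vL κ Φ t p D g f) (RA' κ Φ t p D mk) qB Nr).sLo = sLoY κ Φ t p D g f := rfl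
  rw [hsLo]
  have sL' : (shearUnit (nL κ Φ t p D g f) (hL κ Φ t p D g f) : ℤ) * sLoY κ Φ t p D g f ≤
      (nL κ Φ t p D g f : ℤ) * ℓL κ Φ t p D g f - (shearUnit (nL κ Φ t p D g f) (hL κ Φ t p D g f) : ℤ) + 1 := by unfold sLoY; exact Int.mul_ediv_self_le hU.ne'
  have hs0 : 0 ≤ sLoY κ Φ t p D g f := by unfold sLoY; exact Int.ediv_nonneg (by linarith only [hU2, hnℓ]) hU.le
  have hk1 : ((k + 1 : ℕ) : ℤ) ≤ 1000 * (Neg.Kq κ : ℤ) := by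
    have h3 : k + 1 ≤ 1000 * Neg.Kq κ := by omega
    exact_mod_cast h3
  have hterm := clr_kterm_le hn1 hN.v_le hκ' hU2 hs0 (by linarith only [sL', hU]) (by positivity : (0 : ℤ) ≤ (ℓL κ Φ t p D g f : ℤ))
    (Nat.cast_nonneg _ : (0 : ℤ) ≤ ((k + 1 : ℕ) : ℤ)) hk1
  have hNn0 : 0 ≤ (shearUnit (nL κ Φ t p D g f) (hL κ Φ t p D g f) : ℤ) * |((k + 1 : ℕ) : ℤ) * sLoY κ Φ t p D g f| +
      |hL κ Φ t p D g f| * |((k + 1 : ℕ) : ℤ) * vL κ Φ t p D g f| + (shearUnit (nL κ Φ t p D g f) (hL κ Φ t p D g f) : ℤ) := by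
    have a1 := mul_nonneg hU.le (abs_nonneg (((k + 1 : ℕ) : ℤ) * sLoY κ Φ t p D g f))
    have a2 := mul_nonneg (abs_nonneg (hL κ Φ t p D g f)) (abs_nonneg (((k + 1 : ℕ) : ℤ) * vL κ Φ t p D g f))
    linarith only [a1, a2, hU]
  have hdiv0 := Int.ediv_nonneg hNn0 hn0.le
  have hfl := clr_floorπY_exA κ Φ t p D c mk g f hκ hSF hnA
  refine hr _ (le_trans ?_ hfl)
  rw [← Nat.cast_le (α := ℤ)] at hyl ⊢
  push_cast at hdiv0 hterm
  push_cast [Int.natCast_natAbs] at hyl ⊢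
  rw [abs_of_nonneg hdiv0]
  have hU0' : (0 : ℤ) ≤ 1000 * (Neg.Kq κ : ℤ) * (shearUnit (nL κ Φ t p D g f) (hL κ Φ t p D g f) : ℤ) := by positivity
  linarith only [hyl, hterm, hU0']

/-- **M3 y′-face field `hπ3Y`, generic**: the tangential x-run's origin plus its `(N₃+1)` levels lies within the window radius `r`, from the ONE
r-floor `hr` (`Nr + 1 ≤ 1000·Kq`, `N₃ + 1 ≤ 1000·Kq`, `|yL|₁ ≤ YbF`). [cite: KozmaNitzan2024, §4 Lemma 12 (pp. 23–25)] -/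
theorem hπ3Y_YA_gen (hN : EqNumL κ Φ t p D g f) (hκ : (hL κ Φ t p D g f).natAbs ≤ 10 * nL κ Φ t p D g f)
    (hnA : 2000 * Neg.Kq κ * (RA' κ Φ t p D mk + 2) ≤ nL κ Φ t p D g f) (hℓA : 22000 * Neg.Kq κ * (RA' κ Φ t p D mk + 2) ≤ ℓL κ Φ t p D g f)
    (hSF : 16 * SF κ Φ t p D c mk ≤ ML κ Φ t p D g) (du : MDir) (yL : Site 2) (hyl : (yL 0).natAbs + (yL 1).natAbs ≤ YbF κ Φ t p D c mk g f)
    {Nr N₃ : ℕ} (hNr : Nr + 1 ≤ 1000 * Neg.Kq κ) (hN₃ : N₃ + 1 ≤ 1000 * Neg.Kq κ) (r : ℕ) (hr : ∀ X : ℕ, X + 1 ≤ exA κ Φ t p D g f → X ≤ r) :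
    (((yL + crossOffY (nL κ Φ t p D g f) (ℓL κ Φ t p D g f) (hL κ Φ t p D g f) (vL κ Φ t p D g f) (sgOf du) Nr) 0).natAbs +
        ((yL + crossOffY (nL κ Φ t p D g f) (ℓL κ Φ t p D g f) (hL κ Φ t p D g f) (vL κ Φ t p D g f) (sgOf du) Nr) 1).natAbs) +
      (N₃ + 1) * shearUnit (nL κ Φ t p D g f) (hL κ Φ t p D g f) ≤ r := by
  have hT := clr_crossOffY_l1 κ Φ t p D mk g f hN hκ hℓA yL (sgOf_sign du) Nr
  have hfl := clr_floorπY_exA κ Φ t p D c mk g f hκ hSF hnA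
  refine hr _ (le_trans ?_ hfl)
  have h1 : (Nr + 1) * (11 * nL κ Φ t p D g f + ℓL κ Φ t p D g f) ≤ 1000 * Neg.Kq κ * (11 * nL κ Φ t p D g f + ℓL κ Φ t p D g f) :=
    Nat.mul_le_mul_right _ hNr
  have h2 : (N₃ + 1) * shearUnit (nL κ Φ t p D g f) (hL κ Φ t p D g f) ≤ 1000 * Neg.Kq κ * shearUnit (nL κ Φ t p D g f) (hL κ Φ t p D g f) :=
    Nat.mul_le_mul_right _ hN₃
  have e1 : 1000 * Neg.Kq κ * (11 * nL κ Φ t p D g f + ℓL κ Φ t p D g f) = 11000 * Neg.Kq κ * nL κ Φ t p D g f + 1000 * Neg.Kq κ * ℓL κ Φ t p D g f := by ring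
  omega

end FloorsPiY

end KS

end NegB

end PlanarSkeletonNeg

end Summit.CriticalPhenomena.PercolationContinuityZ3.Theorems.Transplant

end
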